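import Summits.Ventures.HodgeRepro2.T5SU11ImproperHardyClass
import Summits.Ventures.HodgeRepro2.T5SU11ResolventIdentityDecay

/-!
# The resolvent is Lipschitz in the spectral parameter in the `L²(sinh 2t dt)` norm, on the class

For `λ, λ₂ > 1` and a source `g` of the exponentially decaying class at a rate `ε > 1`, the resolvent identity of row 500,
`G^I_λ g − G^I_{λ₂} g = (μ − μ₂) G^I_λ(G^I_{λ₂} g)`, with `G^I_{λ₂} g` again in the class (row 499) and the sharp `L²` bound
of row 532 applied twice, gives

**`‖G^I_λ g − G^I_{λ₂} g‖² ≤ (μ − μ₂)² ‖g‖²/((λ − 1)⁴ (λ₂ − 1)⁴)`** (`integral_sinh_mul_sub_sq_le`)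

— the `L²` counterpart of row 513's Lipschitz bound in the weighted sup-norm, with the sharp constants of row 478; in
particular `λ ↦ G^I_λ g` is continuous into `L²(sinh 2t dt)` on `(1, ∞)` (`tendsto_integral_sinh_mul_sub_sq`).
Nothing is claimed about (N).

Blind lane: Mathlib + the HodgeRepro2 prefix only; no sorry; axioms ⊆ {propext, Classical.choice,
Quot.sound}.
-/

namespace Summit.Ventures.HodgeRepro2.T5SU11ImproperL2Lipschitz

open Filter Topology MeasureTheory
open Set (Ioi Ioc)
open T5SU11Cartan T5SU11SphericalFunction T5SU11SphericalDecay T5SU11RadialGreenImproper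
  T5SU11RadialGreenImproperStable T5SU11ResolventIdentityDecay T5SU11ImproperEnergyBracketAll
  T5SU11ImproperHardyClass

section measure

variable [MeasurableSpace Circle] [BorelSpace Circle]

variable {lam lam₂ : ℝ} (hlam : 1 < lam) (hlam₂ : 1 < lam₂) {g : ℝ → ℝ} (hg : ContinuousOn g (Ioi 0))
  {M : ℝ} (hM : ∀ s ∈ Ioc (0 : ℝ) 1, |g s| ≤ M) (hM0 : 0 ≤ M)
  {ε C s₀ : ℝ} (hC : ∀ s, s₀ ≤ s → |g s| ≤ C * Real.exp (-ε * s)) (hε1 : 1 < ε)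

include hlam hlam₂ hg hM hM0 hC hε1 in
/-- **THE RESOLVENT IS LIPSCHITZ IN `μ` IN THE `L²(sinh 2t dt)` NORM ON THE CLASS**:
`∫_{(0,∞)} sinh 2t (G^I_λ g − G^I_{λ₂} g)² ≤ (μ − μ₂)² (∫_{(0,∞)} sinh 2t g²)/((λ − 1)⁴ (λ₂ − 1)⁴)`. -/
theorem integral_sinh_mul_sub_sq_le :
    ∫ t in Ioi 0, Real.sinh (2 * t) * (greenSolI (fun t => sph lam (hyp t)) (sphDecay lam) g t
        - greenSolI (fun t => sph lam₂ (hyp t)) (sphDecay lam₂) g t) ^ 2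
      ≤ (lam * (lam - 2) - lam₂ * (lam₂ - 2)) ^ 2 * (∫ t in Ioi 0, Real.sinh (2 * t) * g t ^ 2)
          / (((lam - 1) ^ 2) ^ 2 * ((lam₂ - 1) ^ 2) ^ 2) := by
  have hε : 2 - lam < ε := by linarith
  have hε₂ : 2 - lam₂ < ε := by linarith
  -- `h = G^I_{λ₂} g` is in the class at a rate `ε′ ∈ (1, min(ε, λ₂))`
  have hmin : 1 < min ε lam₂ := lt_min hε1 hlam₂
  set ε' := (1 + min ε lam₂) / 2 with hε'
  have hε'1 : 1 < ε' := by rw [hε']; linarith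
  have hε'2 : ε' < min ε lam₂ := by rw [hε']; linarith
  have hε'lam : 2 - lam < ε' := by linarith
  have hh := continuousOn_greenSolI hlam₂ hg hM hM0 hε₂ hC
  obtain ⟨M', hM'0, hM'⟩ := exists_abs_greenSolI_le_of_le_one hlam₂ hg hM hM0 hε₂ hC
  obtain ⟨K, T, hK, hT, hKT⟩ := exists_abs_greenSolI_le_exp hlam₂ hg hM hM0 hε₂ hC hε'2
  set κ := lam * (lam - 2) - lam₂ * (lam₂ - 2) with hκ
  -- the pointwise resolvent identity
  have hid : ∀ t, 0 < t → Real.sinh (2 * t) * (greenSolI (fun t => sph lam (hyp t)) (sphDecay lam) g t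
      - greenSolI (fun t => sph lam₂ (hyp t)) (sphDecay lam₂) g t) ^ 2
      = κ ^ 2 * (Real.sinh (2 * t) * greenSolI (fun t => sph lam (hyp t)) (sphDecay lam)
          (greenSolI (fun t => sph lam₂ (hyp t)) (sphDecay lam₂) g) t ^ 2) := by
    intro t ht
    rw [greenSolI_sub_greenSolI_eq hlam hlam₂ hg hM hM0 hε hε₂ hC ht]
    ring
  have e : ∫ t in Ioi 0, Real.sinh (2 * t) * (greenSolI (fun t => sph lam (hyp t)) (sphDecay lam) g t
      - greenSolI (fun t => sph lam₂ (hyp t)) (sphDecay lam₂) g t) ^ 2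
      = κ ^ 2 * ∫ t in Ioi 0, Real.sinh (2 * t) * greenSolI (fun t => sph lam (hyp t)) (sphDecay lam)
          (greenSolI (fun t => sph lam₂ (hyp t)) (sphDecay lam₂) g) t ^ 2 := by
    rw [← MeasureTheory.integral_const_mul]
    apply setIntegral_congr_fun measurableSet_Ioi
    intro t ht
    exact hid t ht
  -- the two sharp bounds
  have h1 := integral_sinh_mul_greenSolI_sq_le_all hlam hh hM' hM'0 hε'lam hKT hε'1
  have h2 := integral_sinh_mul_greenSolI_sq_le_all hlam₂ hg hM hM0 hε₂ hC hε1
  have hκ2 : 0 ≤ κ ^ 2 := sq_nonneg _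
  have hp1 : 0 < ((lam - 1) ^ 2) ^ 2 := by positivity
  have hp2 : 0 < ((lam₂ - 1) ^ 2) ^ 2 := by positivity
  rw [e]
  calc κ ^ 2 * ∫ t in Ioi 0, Real.sinh (2 * t) * greenSolI (fun t => sph lam (hyp t)) (sphDecay lam)
        (greenSolI (fun t => sph lam₂ (hyp t)) (sphDecay lam₂) g) t ^ 2
      ≤ κ ^ 2 * ((∫ t in Ioi 0, Real.sinh (2 * t) * greenSolI (fun t => sph lam₂ (hyp t)) (sphDecay lam₂) g t ^ 2)
          / ((lam - 1) ^ 2) ^ 2) := mul_le_mul_of_nonneg_left h1 hκ2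
    _ ≤ κ ^ 2 * (((∫ t in Ioi 0, Real.sinh (2 * t) * g t ^ 2) / ((lam₂ - 1) ^ 2) ^ 2) / ((lam - 1) ^ 2) ^ 2) := by
        apply mul_le_mul_of_nonneg_left _ hκ2
        exact div_le_div_of_nonneg_right h2 hp1.le
    _ = κ ^ 2 * (∫ t in Ioi 0, Real.sinh (2 * t) * g t ^ 2) / (((lam - 1) ^ 2) ^ 2 * ((lam₂ - 1) ^ 2) ^ 2) := by
        field_simp

include hlam₂ hg hM hM0 hC hε1 in
/-- **`λ ↦ G^I_λ g` is continuous in `L²(sinh 2t dt)` on the class**: `‖G^I_λ g − G^I_{λ₂} g‖² → 0` as `λ → λ₂` within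
`(1, ∞)`. -/
theorem tendsto_integral_sinh_mul_sub_sq :
    Tendsto (fun lam => ∫ t in Ioi 0, Real.sinh (2 * t) * (greenSolI (fun t => sph lam (hyp t)) (sphDecay lam) g t
        - greenSolI (fun t => sph lam₂ (hyp t)) (sphDecay lam₂) g t) ^ 2) (𝓝[Ioi 1] lam₂) (𝓝 0) := by
  set G := ∫ t in Ioi 0, Real.sinh (2 * t) * g t ^ 2 with hG
  set b : ℝ → ℝ := fun lam => (lam * (lam - 2) - lam₂ * (lam₂ - 2)) ^ 2 * G
    / (((lam - 1) ^ 2) ^ 2 * ((lam₂ - 1) ^ 2) ^ 2) with hb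
  have hb0 : b lam₂ = 0 := by simp [hb]
  have hbc : ContinuousAt b lam₂ := by
    have hden : (((lam₂ - 1) ^ 2) ^ 2 * ((lam₂ - 1) ^ 2) ^ 2) ≠ 0 := by
      have : 0 < lam₂ - 1 := by linarith
      positivity
    exact (((continuous_id.mul (continuous_id.sub continuous_const)).sub continuous_const).pow 2
      |>.mul continuous_const).continuousAt.div
      ((((continuous_id.sub continuous_const).pow 2).pow 2).mul continuous_const).continuousAt hden
  have hlim : Tendsto b (𝓝[Ioi 1] lam₂) (𝓝 0) := by
    rw [← hb0]
    exact hbc.continuousWithinAt.tendsto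
  refine squeeze_zero' ?_ ?_ hlim
  · filter_upwards with lam
    apply setIntegral_nonneg measurableSet_Ioi
    intro t ht
    have ht0 : 0 < t := ht
    exact mul_nonneg (Real.sinh_nonneg_iff.mpr (by linarith)) (sq_nonneg _)
  · filter_upwards [self_mem_nhdsWithin] with lam hlam
    exact integral_sinh_mul_sub_sq_le hlam hlam₂ hg hM hM0 hC hε1

end measure

end Summit.Ventures.HodgeRepro2.T5SU11ImproperL2Lipschitz
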